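import Summits.NavierStokesRegularity.NavierStokesRegularity.Theorems.SoloSalvageWu2026ConstructPieceEBounds
import HarnessLib

/-!
# C177 `Wu2026` — `Step_construct`, residual hypothesis (G2) HOLDS: the uniform local `L^{9/5}`
# gradient bound of the blow-downs at good scales on balls of the exterior `{|y| > 1}`

Seat `ns-in-wu-341` (cut owner `ns-inputs-plan` g5, kits/A3-G.md: «(G2): owner wu-341 … Final
theorem: `step_construct_G2 : <text of (G2) verbatim>`»; the consumer is wu-con's
`step_construct_pieceE_of_localGradBound (hG2)`, `SoloSalvageWu2026ConstructSobolevE.lean`).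
Salvage conventions: theorems only, standard axioms, no definition, no named fact; `--supports`
item 0897.

Print (arXiv:2608.22471v1, p.13 (3.32)–(3.34)): at good scales `j ≥ max{1, N}` the blow-downs
`V_j = 2^{2n_j/3} v(2^{n_j}·)` satisfy `‖∇V_j‖_{L^{9/5}(G)} ≤ C_{G,G′}` on `G ⋐ {|y| > 1}`.

* `step_construct_G2` — for every ball `B(c, r)` with `1 + r < |c|` there is `C` with
  `∫_{B(c,r)} |DV_j|^{9/5} ≤ C` for ALL `j`: choose `N` with
  `B(c, r) ⊆ {1 + 1/(N+3) ≤ |y| ≤ 2^{N+1} − 1/3}` (where the shell cut-off `χ_N = 1`), use the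
  uniform bound `‖D(χ_N V_j)‖_{9/5} ≤ M_N` of `pieceE_uniform_bounds` (`…ConstructPieceEBounds`) for
  `j ≥ max{1,N}` (`D(χ_N V_j) = DV_j` on the open ball), and absorb the finitely many earlier
  scales into the constant.

WHAT THIS IS NOT: not a proof of `Step_construct` (wu-con's assembly `step_construct_of_gradBounds`
consumes (G1), (G2), (B)); not a claim about NS regularity or blow-up; not a claim about any
author beyond the typed locator.
-/

noncomputable section

set_option linter.dupNamespace false

open MeasureTheory Set Function Filter Topology Metric
open scoped ENNReal NNReal RealInnerProductSpace ContDiff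

namespace Summit.NavierStokesRegularity.NavierStokesRegularity.Theorems.Wu2026Salvage

open Literature.Claims.NS.Wu2026 Literature.Analysis.FluidPDE Literature.Analysis.FunctionSpaces

/-- **Choice of the shell index for a ball of the exterior**: if `1 + r < |c|` there is `N`
with `1 + 1/(N+3) ≤ |c| − r` and `|c| + r ≤ 2^{N+1} − 1/3`. [folklore] -/
theorem exists_shellIndex {c : E3} {r : ℝ} (hcr : 1 + r < ‖c‖) :
    ∃ N : ℕ, 1 + 1 / ((N : ℝ) + 3) ≤ ‖c‖ - r ∧ ‖c‖ + r ≤ (2 : ℝ) ^ (N + 1) - 1 / 3 := by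
  have hδ : 0 < ‖c‖ - r - 1 := by linarith
  obtain ⟨N₀, hN₀⟩ := exists_nat_one_div_lt hδ
  obtain ⟨N₂, hN₂⟩ := exists_nat_ge (‖c‖ + r + 1)
  refine ⟨max N₀ N₂, ?_, ?_⟩
  · have h1 : 1 / ((max N₀ N₂ : ℕ) + 3 : ℝ) ≤ 1 / ((N₀ : ℝ) + 1) := by
      apply one_div_le_one_div_of_le (by positivity)
      have : (N₀ : ℝ) ≤ (max N₀ N₂ : ℕ) := by exact_mod_cast le_max_left N₀ N₂
      linarith
    linarith
  · have h2 : ((max N₀ N₂ : ℕ) : ℝ) + 1 < (2 : ℝ) ^ (max N₀ N₂ + 1) := by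
      have := Nat.lt_two_pow_self (n := max N₀ N₂ + 1)
      exact_mod_cast this
    have h3 : (N₂ : ℝ) ≤ (max N₀ N₂ : ℕ) := by exact_mod_cast le_max_right N₀ N₂
    linarith

/-- **(G2) — the residual Sobolev hypothesis of `Step_construct`**, verbatim the binder `hG2` of
`step_construct_pieceE_of_localGradBound`: at the good scales of Lemma 3.1 the blow-downs have
`∫_{B(c,r)} |DV_j|^{9/5} ≤ C` for every ball with `1 + r < |c|`, uniformly in `j` ((3.34) with the
shell cut-offs; the strong bounds (3.32) `∫_{A_{2^m}}|curl V_j|^{9/5} = a_{n_j+m} ≤ B_m` and (3.33)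
feed the tree's div–curl estimate). [cite: Wu2026, (3.32)–(3.34) p.13 l.1–40] -/
theorem step_construct_G2 : ∀ ν : ℝ, 0 < ν → ∀ (v : E3 → E3) (p : E3 → ℝ), IsWuFlow ν v p →
      MemWeakLp v ((9 : ℝ≥0∞) / 2) volume →
      (∀ q : ℝ, 1 < q → q < 9 / 2 → ∃ C : ℝ, ∀ R : ℝ, 0 < R →
        IntegrableOn (fun x => ‖v x‖ ^ q) (annulus R) ∧
        (∫ x in annulus R, ‖v x‖ ^ q) ^ (1 / q) ≤ C * R ^ (-(2 : ℝ) / 3 + 3 / q)) →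
      ∀ n : ℕ → ℕ, Tendsto n atTop atTop →
        (∀ m : ℕ, ∃ B : ℝ, ∀ j : ℕ, max 1 m ≤ j → dyMass v (n j + m) ≤ B) →
      ∀ c : E3, ∀ r : ℝ, 0 < r → 1 + r < ‖c‖ → ∃ C : ℝ, ∀ j : ℕ,
        ∫ y in ball c r, ‖fderiv ℝ (blowDown ((2 : ℝ) ^ n j) v) y‖ ^ ((9 : ℝ) / 5) ≤ C := by
  intro ν _hν v p hf _hvw h318 n _hn hgood c r hr hcr
  obtain ⟨N, hN1, hN2⟩ := exists_shellIndex hcr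
  obtain ⟨χ, hχs, _hχc, _hχ01, hχ1, _hχS, M, hMt, hbd⟩ := pieceE_uniform_bounds hf h318 hgood N
  have h95 : ((9 : ℝ≥0∞) / 5).toReal = 9 / 5 := by rw [ENNReal.toReal_div]; norm_num
  have h0 : ((9 : ℝ≥0∞) / 5) ≠ 0 := by norm_num
  have ht : ((9 : ℝ≥0∞) / 5) ≠ ⊤ := ENNReal.div_ne_top (by norm_num) (by norm_num)
  -- `χ = 1` on the (open) ball
  have hχball : ∀ y ∈ ball c r, χ y = 1 := fun y hy => by
    rw [mem_ball, dist_eq_norm] at hy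
    have h1 : ‖c‖ - r < ‖y‖ := by
      have := norm_sub_norm_le c y; rw [norm_sub_rev] at this; linarith
    have h2 : ‖y‖ < ‖c‖ + r := by
      have := norm_le_insert' y c; linarith
    exact hχ1 y (by linarith) (by linarith)
  -- the integrals
  set I : ℕ → ℝ := fun j =>
    ∫ y in ball c r, ‖fderiv ℝ (blowDown ((2 : ℝ) ^ n j) v) y‖ ^ ((9 : ℝ) / 5) with hI
  have hI0 : ∀ j, 0 ≤ I j := fun j => integral_nonneg fun y => Real.rpow_nonneg (norm_nonneg _) _
  -- the bound at good scales
  have hMpow : M ^ ((9 : ℝ) / 5) ≠ ⊤ := ENNReal.rpow_ne_top_of_nonneg (by norm_num) hMt.ne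
  have hgoodj : ∀ j, max 1 N ≤ j → I j ≤ (M ^ ((9 : ℝ) / 5)).toReal := by
    intro j hj
    set V : E3 → E3 := blowDown ((2 : ℝ) ^ n j) v with hV
    set W : E3 → E3 := fun y => χ y • V y with hW
    have hVs : ContDiff ℝ ∞ V := contDiff_blowDown hf.smooth_v _
    have hDVc : Continuous (fderiv ℝ V) := hVs.continuous_fderiv (by simp)
    -- `DW = DV` on the ball
    have hDeq : ∀ y ∈ ball c r, fderiv ℝ W y = fderiv ℝ V y := fun y hy => by
      have hev : W =ᶠ[𝓝 y] V := by
        filter_upwards [isOpen_ball.mem_nhds hy] with z hz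
        rw [hW]; simp only [hχball z hz, one_smul]
      exact hev.fderiv_eq
    -- the integral as a `lintegral`
    have hint : IntegrableOn (fun y => ‖fderiv ℝ V y‖ ^ ((9 : ℝ) / 5)) (ball c r) volume :=
      ((hDVc.norm.rpow_const fun _ => Or.inr (by norm_num)).continuousOn.integrableOn_compact
        (isCompact_closedBall c r)).mono_set ball_subset_closedBall
    have h1 : ENNReal.ofReal (I j) = ∫⁻ y in ball c r, ‖fderiv ℝ W y‖ₑ ^ ((9 : ℝ) / 5) := by
      rw [hI]
      simp only
      rw [ofReal_integral_eq_lintegral_ofReal hint (Eventually.of_forall fun y =>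
        Real.rpow_nonneg (norm_nonneg _) _)]
      refine setLIntegral_congr_fun measurableSet_ball fun y hy => ?_
      rw [ofReal_norm_rpow _ (by norm_num), hDeq y hy]
    have h2 : ∫⁻ y in ball c r, ‖fderiv ℝ W y‖ₑ ^ ((9 : ℝ) / 5) ≤ M ^ ((9 : ℝ) / 5) := by
      calc ∫⁻ y in ball c r, ‖fderiv ℝ W y‖ₑ ^ ((9 : ℝ) / 5)
          ≤ ∫⁻ y, ‖fderiv ℝ W y‖ₑ ^ ((9 : ℝ) / 5) := setLIntegral_le_lintegral _ _
        _ = eLpNorm (fderiv ℝ W) ((9 : ℝ≥0∞) / 5) volume ^ ((9 : ℝ) / 5) := by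
            rw [← h95, eLpNorm_eq_eLpNorm' h0 ht,
              ← lintegral_rpow_enorm_eq_rpow_eLpNorm' (by rw [h95]; norm_num)]
        _ ≤ M ^ ((9 : ℝ) / 5) := ENNReal.rpow_le_rpow (hbd j hj).1 (by norm_num)
    rw [← ENNReal.ofReal_le_iff_le_toReal hMpow, h1]
    exact h2
  -- absorb the finitely many early scales
  refine ⟨(∑ j ∈ Finset.range (max 1 N), I j) + (M ^ ((9 : ℝ) / 5)).toReal, fun j => ?_⟩
  have hsum0 : 0 ≤ ∑ j ∈ Finset.range (max 1 N), I j := Finset.sum_nonneg fun j _ => hI0 j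
  rcases lt_or_ge j (max 1 N) with hj | hj
  · have hle : I j ≤ ∑ j ∈ Finset.range (max 1 N), I j :=
      Finset.single_le_sum (fun j _ => hI0 j) (Finset.mem_range.2 hj)
    show I j ≤ _
    linarith [ENNReal.toReal_nonneg (a := M ^ ((9 : ℝ) / 5))]
  · show I j ≤ _
    linarith [hgoodj j hj]

end Summit.NavierStokesRegularity.NavierStokesRegularity.Theorems.Wu2026Salvage

end

-- WHAT THIS IS NOT: not a claim about NS regularity or blow-up; not a claim about any author beyond the typed locator.
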